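import Mathlib
import Literature.Probability.Percolation.PercolationProofs
import Literature.Probability.LatticeModels.ProdBernoulliIndependence
import Literature.Probability.LatticeModels.ProdBernoulliClusterLocality
import Literature.Probability.Percolation.ConditionalPositiveAssociation
import Literature.Probability.Percolation.ConditionalPositiveAssociationProofs
import Literature.Probability.Percolation.TwoClusterConditionalAssociation
import Literature.Probability.Percolation.TwoClusterConditionalAssociationProofs
import Summits.CriticalPhenomena.PercolationContinuityZ3.Theorems.PercNearOneGluingNearOneGluingKnLemma3i
import HarnessLib

/-! # Crux `PercNearOneGluing.AdditiveGluing` (stmt-CriticalPhenomena-4576), line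
`sigma-recursion-lemma5-any-relay` — stub `stub_knLemma3ii`

Helper file for the crux skeleton
`Cruxes/AdditiveGluing/Lines/sigma-recursion-lemma5-any-relay.lean` (lead
prover-line-stmt-CriticalPhenomena-4576-0).  Proves exactly the registered stub signature
`stub_knLemma3ii`; lands with `--supports stmt-CriticalPhenomena-4576`.

## Content

Kozma–Nitzan, arXiv:2401.12397, **Lemma 3(ii)** (pp. 6–7), in denominator-free form on the finite
weighted graph `Fin n` (`μ = prodBernoulli w` on `BondConfig (Fin n) = Set (Sym2 (Fin n))`): if
`μ(a₁ ↔ b) ≤ μ(a₂ ↔ b) + d` with `d ≥ 0` and `Q` is DECREASING and determined by the open edge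
cluster `C_{a₁}` of `a₁` (hypothesis: `ω' ∈ Q`, `C_{a₁} ω ⊆ C_{a₁} ω'` ⇒ `ω ∈ Q`), then
`μ({a₁ ↔ b} ∩ Q) ≤ μ({a₂ ↔ b} ∩ Q) + d`.

Proof (KN pp. 6–7; same structure as the sibling `knLemma3i` for part (i)).  Put
`D = {a₁ ↮ a₂}`.  Off `D` the events `{a₁ ↔ b}` and `{a₂ ↔ b}` coincide, so it suffices to
compare the parts on `D`.  With `m = μ(D)`, `x_i = μ(D ∩ {a_i ↔ b})`,
`y_i = μ(D ∩ {a_i ↔ b} ∩ Q)`, `y_i' = μ(D ∩ {a_i ↔ b} ∩ Qᶜ)`, `q = μ(D ∩ Q)`, `q' = μ(D ∩ Qᶜ)`,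
the complement `Qᶜ` is INCREASING and determined by `C_{a₁}`, so the two landed BHK helper
lemmas of the sibling file apply to it:
* `knLemma3i_oneCluster` (van den Berg–Häggström–Kahn 2006, Thm. 1.3, `s = a₁`, `X = {a₂}`,
  `f = 1{a₁ ↔ b}`, `g = 1_{Qᶜ}`): `x₁ q' ≤ m y₁'`, i.e. (subtracting from `x₁ m`) `m y₁ ≤ x₁ q`;
* `knLemma3i_twoCluster` (BHK 2006, Thm. 1.4, `s = a₂`, `t = a₁`, `f = 1{a₂ ↔ b}`,
  `g = 1_{Qᶜ}`): `m y₂' ≤ x₂ q'`, i.e. `x₂ q ≤ m y₂`.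
Hence `m y₁ ≤ x₁ q ≤ (x₂ + d) q ≤ m y₂ + d q ≤ m y₂ + d m`, and `y₁ ≤ y₂ + d` (trivially if
`m = 0`; the case `a₁ = a₂` is trivial too).  The real arithmetic is isolated in
`knLemma3ii_arith`.
-/

namespace Summit.CriticalPhenomena.PercolationContinuityZ3.Theorems

open MeasureTheory Set
open Literature.Probability.LatticeModels (prodBernoulli)
open Literature.Probability.Percolation (BondConfig openConn openGraph openEdgeCluster)

noncomputable section
open Classical

/-- Real-arithmetic core of KN Lemma 3(ii): with `m = q + q'`, `x₁ = y₁ + y₁'`,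
`x₂ = y₂ + y₂'`, the one-cluster bound `x₁ q' ≤ m y₁'`, the two-cluster bound `m y₂' ≤ x₂ q'`
and `x₁ ≤ x₂ + d` give `y₁ ≤ y₂ + d`. [folklore] -/
theorem knLemma3ii_arith {m x₁ x₂ y₁ y₂ y₁' y₂' q q' d : ℝ}
    (hd : 0 ≤ d) (hq0 : 0 ≤ q) (hq'0 : 0 ≤ q') (hy₂0 : 0 ≤ y₂) (hy₁m : y₁ ≤ m)
    (hq : q + q' = m) (hx1 : y₁ + y₁' = x₁) (hx2 : y₂ + y₂' = x₂)
    (hI : x₁ * q' ≤ m * y₁') (hII : m * y₂' ≤ x₂ * q') (hx : x₁ ≤ x₂ + d) :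
    y₁ ≤ y₂ + d := by
  subst hq hx1 hx2
  rcases eq_or_lt_of_le (add_nonneg hq0 hq'0) with hm0 | hmpos
  · linarith
  · have hA : (q + q') * y₁ ≤ (y₁ + y₁') * q := by linarith
    have hB : (y₂ + y₂') * q ≤ (q + q') * y₂ := by linarith
    have hqm : q ≤ q + q' := by linarith
    refine le_of_mul_le_mul_left ?_ hmpos
    calc (q + q') * y₁ ≤ (y₁ + y₁') * q := hA
      _ ≤ (y₂ + y₂' + d) * q := mul_le_mul_of_nonneg_right hx hq0
      _ = (y₂ + y₂') * q + d * q := add_mul _ _ _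
      _ ≤ (q + q') * y₂ + d * (q + q') := add_le_add hB (mul_le_mul_of_nonneg_left hqm hd)
      _ = (q + q') * (y₂ + d) := by ring

/-- **Kozma–Nitzan arXiv:2401.12397 Lemma 3(ii) (pp. 6–7), denominator-free.**  If
`P(a₁ ↔ b) ≤ P(a₂ ↔ b) + d` (`d ≥ 0`) and `Q` is DECREASING and determined by the open edge
cluster of `a₁` (`ω' ∈ Q`, `C_{a₁} ω ⊆ C_{a₁} ω'` ⇒ `ω ∈ Q`), then
`P({a₁ ↔ b} ∩ Q) ≤ P({a₂ ↔ b} ∩ Q) + d`.  From BHK 2006 Thm 1.3 and Thm 1.4 applied to the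
increasing complement `Qᶜ` (`knLemma3i_oneCluster`, `knLemma3i_twoCluster`, both proved in the
tree). [cite: KozmaNitzan2024, Lemma 3(ii)] -/
theorem stub_knLemma3ii :
    ∀ (n : ℕ) (w : Sym2 (Fin n) → unitInterval) (a₁ a₂ b : Fin n) (Q : Set (BondConfig (Fin n)))
      (d : ℝ),
      (∀ ω ω' : BondConfig (Fin n), ω' ∈ Q → openEdgeCluster ω a₁ ⊆ openEdgeCluster ω' a₁ → ω ∈ Q) →
      0 ≤ d →
      (prodBernoulli w).real (openConn a₁ b) ≤ (prodBernoulli w).real (openConn a₂ b) + d →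
      (prodBernoulli w).real (openConn a₁ b ∩ Q) ≤ (prodBernoulli w).real (openConn a₂ b ∩ Q) + d
    := by
  intro n w a₁ a₂ b Q d hQ hd hle
  rcases eq_or_ne a₁ a₂ with h12 | h12
  · subst h12
    exact le_add_of_nonneg_right hd
  -- the complement `Qᶜ` is increasing and determined by `C_{a₁}`
  have hQc : ∀ ω ω' : BondConfig (Fin n), ω ∈ Qᶜ →
      openEdgeCluster ω a₁ ⊆ openEdgeCluster ω' a₁ → ω' ∈ Qᶜ :=
    fun ω ω' hω hsub hω' => hω (hQ ω ω' hω' hsub)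
  -- `D = {a₁ ↮ a₂} = (openConn a₁ a₂)ᶜ`
  have hDm : MeasurableSet ((openConn a₁ a₂)ᶜ : Set (BondConfig (Fin n))) :=
    MeasurableSet.of_discrete
  have hQm : MeasurableSet (Q : Set (BondConfig (Fin n))) := MeasurableSet.of_discrete
  -- (1) on `{a₁ ↔ a₂}` the events `{a₁ ↔ b}` and `{a₂ ↔ b}` coincide
  have hagree : ∀ E : Set (BondConfig (Fin n)),
      (openConn a₁ b ∩ E) \ (openConn a₁ a₂)ᶜ = (openConn a₂ b ∩ E) \ (openConn a₁ a₂)ᶜ := by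
    intro E
    ext ω
    simp only [Set.mem_sdiff, Set.mem_inter_iff, Set.mem_compl_iff, not_not]
    constructor
    · rintro ⟨⟨h1, hE⟩, h2⟩
      exact ⟨⟨SimpleGraph.Reachable.trans (SimpleGraph.Reachable.symm h2) h1, hE⟩, h2⟩
    · rintro ⟨⟨h1, hE⟩, h2⟩
      exact ⟨⟨SimpleGraph.Reachable.trans h2 h1, hE⟩, h2⟩
  have hs1 := measureReal_inter_add_sdiff (μ := prodBernoulli w) (s := openConn a₁ b) hDm
  have hs2 := measureReal_inter_add_sdiff (μ := prodBernoulli w) (s := openConn a₂ b) hDm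
  have hs1Q := measureReal_inter_add_sdiff (μ := prodBernoulli w) (s := openConn a₁ b ∩ Q) hDm
  have hs2Q := measureReal_inter_add_sdiff (μ := prodBernoulli w) (s := openConn a₂ b ∩ Q) hDm
  have he : (prodBernoulli w).real (openConn a₁ b \ (openConn a₁ a₂)ᶜ) =
      (prodBernoulli w).real (openConn a₂ b \ (openConn a₁ a₂)ᶜ) := by
    have h := hagree Set.univ
    simp only [Set.inter_univ] at h
    rw [h]
  have heQ : (prodBernoulli w).real ((openConn a₁ b ∩ Q) \ (openConn a₁ a₂)ᶜ) =
      (prodBernoulli w).real ((openConn a₂ b ∩ Q) \ (openConn a₁ a₂)ᶜ) := by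
    rw [hagree Q]
  rw [Set.inter_comm (openConn a₁ b) (openConn a₁ a₂)ᶜ] at hs1
  rw [Set.inter_comm (openConn a₂ b) (openConn a₁ a₂)ᶜ] at hs2
  rw [Set.inter_comm (openConn a₁ b ∩ Q) (openConn a₁ a₂)ᶜ] at hs1Q
  rw [Set.inter_comm (openConn a₂ b ∩ Q) (openConn a₁ a₂)ᶜ] at hs2Q
  -- (2) split the parts on `D` along `Q` / `Qᶜ`
  have hsplit : ∀ E : Set (BondConfig (Fin n)),
      (prodBernoulli w).real (E ∩ Q) + (prodBernoulli w).real (E ∩ Qᶜ) =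
        (prodBernoulli w).real E := by
    intro E
    rw [← Set.sdiff_eq]
    exact measureReal_inter_add_sdiff hQm
  have hq := hsplit (openConn a₁ a₂)ᶜ
  have hx1 := hsplit ((openConn a₁ a₂)ᶜ ∩ openConn a₁ b)
  have hx2 := hsplit ((openConn a₁ a₂)ᶜ ∩ openConn a₂ b)
  simp only [Set.inter_assoc] at hx1 hx2
  -- (3) BHK Thm. 1.3 (`s = a₁`, `X = {a₂}`) and Thm. 1.4 (`s = a₂`, `t = a₁`) for `Qᶜ`
  have hI := knLemma3i_oneCluster w a₁ a₂ b Qᶜ hQc h12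
  have hII := knLemma3i_twoCluster w a₂ a₁ b Qᶜ hQc h12.symm
  have hcomm : (openConn a₂ a₁ : Set (BondConfig (Fin n))) = openConn a₁ a₂ :=
    Set.ext fun _ => ⟨fun h => SimpleGraph.Reachable.symm h, fun h => SimpleGraph.Reachable.symm h⟩
  rw [hcomm] at hII
  -- (4) combine
  have hx : (prodBernoulli w).real ((openConn a₁ a₂)ᶜ ∩ openConn a₁ b) ≤
      (prodBernoulli w).real ((openConn a₁ a₂)ᶜ ∩ openConn a₂ b) + d := by
    linarith
  have hfin : (prodBernoulli w).real ((openConn a₁ a₂)ᶜ ∩ (openConn a₁ b ∩ Q)) ≤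
      (prodBernoulli w).real ((openConn a₁ a₂)ᶜ ∩ (openConn a₂ b ∩ Q)) + d :=
    knLemma3ii_arith hd measureReal_nonneg measureReal_nonneg measureReal_nonneg
      (measureReal_mono Set.inter_subset_left (measure_ne_top _ _)) hq hx1 hx2 hI hII hx
  linarith

end

end Summit.CriticalPhenomena.PercolationContinuityZ3.Theorems
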